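import Mathlib
import Literature.Analysis.ODE.CodeListSimplification
import Summits.Ventures.FusionMHD.Models.CerfonFreidbergIterLikeQHalfShearLink
import Summits.Ventures.FusionMHD.Models.CerfonFreidbergIterLikeQHalfGGJ
import HarnessLib

/-!
# Ventures/FusionMHD — Models/CerfonFreidbergIterLikeQHalfGrad.lean: the GRADIENT-SQUARED field `G = |∇U|² = U_X² + U_Y²` of THE Cerfon–Freidberg
# ITER-like flux along polar rays as a CODE LIST — `G = D_r² + (∂_θU/s)²`, its `s`-derivative by Moore (4.21), eight range boxes `|∂_s G| ≤ 39`,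
# and the algebraic floor `G ≥ D_r²`

HONEST FRAMING (LADDER-GRIDFUSION three columns; CF rung, F2 item R2; «F2.R2-CF-MERCIER-IMPLICIT» step (4) infrastructure, LOW, no count).
The three `G`-registers of Jardin's (8.134) on the CF rung (`Aσ = ∫R s/(D G)`, `A_R = ∫R³ s/(D G)`, `A_B1 = ∫s/(R D G)`, `…QHalfMercDefs`) need, for
the tube link, a Lipschitz constant of `G(θ, ·)` on each tube and a positive floor of `G`.  Here:
* §1 `tS = ∂_θ` of `PolarPanel.gExpr` (folded), **`dθ_eval_eq`** (`= s·(−U_X sin θ + U_Y cos θ)`), the code list **`GS = d1S² + (tS/s)²`** with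
  **`GS_eval_eq : GS.eval (pt θ s) = Gfield θ s`** (`s ≠ 0`; rotation identity `D² + T² = U_X² + U_Y²`), and **`Dfield_sq_le_Gfield`**;
* §2 **`hasDerivAt_Gfield`**: `HasDerivAt (Gfield θ) (GsField θ s) s` for `X > 0`, `s ≠ 0`, `GsField := (pderivS 10 GS).eval ∘ pt`;
* §3 the EIGHT boxes of record (`…QHalfShearLink.f3Box`, four panels × union of tubes): `gsok_all` (one `decide`, natural interval extension of the
  5 342-node folded code list): `|∂_s G| ≤ 39` on every box; `Gs_abs_of_gsok`, `G_lipschitz_of_Gs`.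
CERTIFIED: kernel (this file + imports, axioms standard).  VALIDATED (never used): probe values `|∂_s G| ≤ 7.6 … 38.8` per box.  MODELLED: analytic
Cerfon–Freidberg family; derivatives of a MODEL flux — nothing about a device or stability.  Typer/prover: gridfusion-model-7 (g7), 2026-08-27.
Citations: Moore 1979 §4.3 (4.21) [Moore1979]; Freidberg 2014 §6.6.1 (6.153) [Freidberg2014]; Jardin 2010 §8.5 (8.134) [Jardin2010].
-/

noncomputable section

open Set MeasureTheory intervalIntegral Filter Topology NonemptyInterval
open Literature.Analysis.ODE Literature.Analysis.ODE.FExpr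
open Literature.Analysis.ValidatedNumerics Literature.Analysis.ValidatedNumerics.ITaylor
open Literature.MathematicalPhysics.MHD Literature.MathematicalPhysics.MHD.CerfonFreidberg
open Summit.Ventures.FusionMHD.Models.PolarRay
open Summit.Ventures.FusionMHD.Models.CFIterLike.PolarPanel

set_option autoImplicit false

namespace Summit.Ventures.FusionMHD.Models.CFIterLike.QHalf

/-! ## §1 `G` as a code list -/

/-- The constant-folded code list of `∂_θ G` (`G = U(ray) − U_a/2`). -/
def tS : FExpr 11 := pderivS 9 gExpr

/-- **`∂_θ` of the code list is `s·(−U_X sin θ + U_Y cos θ)`** (closed forms `UXc`, `UYc`). -/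
theorem dθ_eval_eq (y : Fin 11 → ℝ) :
    (gExpr.pderiv 9).eval y = y 10 * (-(UXc (cOf y) (y 7 + y 10 * Real.cos (y 9)) (y 10 * Real.sin (y 9))) * Real.sin (y 9)
      + UYc (cOf y) (y 7 + y 10 * Real.cos (y 9)) (y 10 * Real.sin (y 9)) * Real.cos (y 9)) := by
  simp only [gExpr, FExpr.pderiv, FExpr.eval, UXc, UYc, cOf]
  simp
  field_simp
  ring

/-- **The code list of `G = |∇U|²` along rays**: `d1S² + (tS/s)²` (`D_r² + T²`, `T = ∂_θU(ray)/s = −U_X sin θ + U_Y cos θ`). -/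
def GS : FExpr 11 := add (pow d1S 2) (pow (div tS (var 10)) 2)

/-- The constant-folded code list of `∂_s G`. -/
def GsS : FExpr 11 := pderivS 10 GS

/-- **`GsField θ s`** — `∂_s G` at the instance point (no closed form written). -/
def GsField (θ s : ℝ) : ℝ := GsS.eval (pt θ s)

/-- The rotation identity: `D_r² + T² = U_X² + U_Y²`. [folklore] -/
theorem rot_identity (c : Fin 7 → ℝ) (X Y θ : ℝ) :
    (UXc c X Y * Real.cos θ + UYc c X Y * Real.sin θ) ^ 2 + (-(UXc c X Y) * Real.sin θ + UYc c X Y * Real.cos θ) ^ 2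
      = UXc c X Y ^ 2 + UYc c X Y ^ 2 := by
  have h := Real.sin_sq_add_cos_sq θ
  linear_combination (UXc c X Y ^ 2 + UYc c X Y ^ 2) * h

/-- **`G ≥ D_r²`** pointwise (`G − D_r² = T² ≥ 0`). [folklore] -/
theorem Dfield_sq_le_Gfield (θ s : ℝ) : Dfield θ s ^ 2 ≤ Gfield θ s := by
  unfold Dfield Drc Gfield
  rw [← rot_identity coeff (Xa + s * Real.cos θ) (s * Real.sin θ) θ]
  nlinarith [sq_nonneg (-(UXc coeff (Xa + s * Real.cos θ) (s * Real.sin θ)) * Real.sin θ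
    + UYc coeff (Xa + s * Real.cos θ) (s * Real.sin θ) * Real.cos θ)]

/-- **`GS` IS `Gfield`** at every instance point with `s ≠ 0`. -/
theorem GS_eval_eq {θ s : ℝ} (hs : s ≠ 0) : GS.eval (pt θ s) = Gfield θ s := by
  obtain ⟨e7, e9, e10⟩ := pt_coords θ s
  have h1 : d1S.eval (pt θ s) = Drc coeff Xa s θ := by rw [d1S_eval, dExpr_eval_eq, cOf_pt, e7, e9, e10]
  have h2 : tS.eval (pt θ s) = s * (-(UXc coeff (Xa + s * Real.cos θ) (s * Real.sin θ)) * Real.sin θ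
      + UYc coeff (Xa + s * Real.cos θ) (s * Real.sin θ) * Real.cos θ) := by
    unfold tS; rw [eval_pderivS 9 (pt θ s) gExpr, dθ_eval_eq, cOf_pt, e7, e9, e10]
  have h3 : (FExpr.var (10 : Fin 11)).eval (pt θ s) = s := by simp only [FExpr.eval]; exact e10
  show (d1S.eval (pt θ s)) ^ 2 + (tS.eval (pt θ s) / (FExpr.var (10 : Fin 11)).eval (pt θ s)) ^ 2 = Gfield θ s
  rw [h1, h2, h3, mul_div_cancel_left₀ _ hs]
  unfold Drc Gfield
  exact rot_identity coeff _ _ θ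

/-! ## §2 The `s`-derivative of `G` -/

/-- Domains: `X > 0` and `s ≠ 0` put the instance point in the domain of `GS` (and of `GsS`). -/
theorem GS_dom {y : Fin 11 → ℝ} (hX : 0 < y 7 + y 10 * Real.cos (y 9)) (hs : y 10 ≠ 0) : GS.dom y ∧ GsS.dom y := by
  obtain ⟨hg, -, h1, -, -, -⟩ := doms_of_X_pos hX
  have ht : tS.dom y := dom_pderivS 9 gExpr hg
  have hG : GS.dom y := by
    refine ⟨?_, ?_⟩
    · exact h1
    · exact ⟨ht, trivial, hs⟩
  exact ⟨hG, dom_pderivS 10 GS hG⟩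

/-- **`∂_s G`**: for `X = X_a + s cos θ > 0` and `s ≠ 0`, `HasDerivAt (Gfield θ) (GsField θ s) s`. -/
theorem hasDerivAt_Gfield {θ s : ℝ} (hX : 0 < Xa + s * Real.cos θ) (hs : s ≠ 0) : HasDerivAt (Gfield θ) (GsField θ s) s := by
  obtain ⟨e7, e9, e10⟩ := pt_coords θ s
  have hX' : 0 < pt θ s 7 + pt θ s 10 * Real.cos (pt θ s 9) := by rw [e7, e9, e10]; exact hX
  have hs' : pt θ s 10 ≠ 0 := by rw [e10]; exact hs
  obtain ⟨hdom, -⟩ := GS_dom hX' hs'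
  have hd := hasDerivAt_eval_update 10 (pt θ s) GS (s := s) (by rw [update_pt]; exact hdom)
  rw [update_pt] at hd
  have hv : (pderiv 10 GS).eval (pt θ s) = GsField θ s := by
    unfold GsField GsS; rw [eval_pderivS 10 (pt θ s) GS]
  rw [hv] at hd
  have hopen : ∀ᶠ r in 𝓝 s, GS.eval (Function.update (pt θ s) 10 r) = Gfield θ r := by
    have hev : ∀ᶠ r in 𝓝 s, r ≠ 0 := isOpen_ne.mem_nhds hs
    filter_upwards [hev] with r hr
    rw [update_pt, GS_eval_eq hr]
  exact hd.congr_of_eventuallyEq (Filter.EventuallyEq.symm hopen)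

/-! ## §3 Range boxes of `∂_s G` -/

/-- The bound of record `M_G = 39` on `|∂_s G|` over every box. -/
def MGQ : ℚ := 39

/-- The box obligation for `∂_s G` on box `g` of `f3Box`. -/
def gsok (g : ℕ) : Bool :=
  let B := f3Box g
  if h : B.1 ≤ B.2.1 ∧ B.2.2.1 ≤ B.2.2.2 then
    evalBoxLE cfgF3 GsS (regionBox B.1 B.2.1 B.2.2.1 B.2.2.2 h.1 h.2) ⟨(-MGQ, MGQ), by norm_num [MGQ]⟩
  else false

/-- **KERNEL CHECK of the eight `∂_s G` boxes** (natural interval extension; seconds). -/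
theorem gsok_all : ∀ g < 8, gsok g = true := by decide +kernel

/-- **`|GsField| ≤ M_G` on box `g`.** -/
theorem Gs_abs_of_gsok {g : ℕ} (h : gsok g = true) {θ s : ℝ}
    (hθ : (((f3Box g).1 : ℚ) : ℝ) ≤ θ ∧ θ ≤ (((f3Box g).2.1 : ℚ) : ℝ))
    (hs : (((f3Box g).2.2.1 : ℚ) : ℝ) ≤ s ∧ s ≤ (((f3Box g).2.2.2 : ℚ) : ℝ)) : |GsField θ s| ≤ ((MGQ : ℚ) : ℝ) := by
  unfold gsok at h
  simp only at h
  split_ifs at h with hB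
  have hm := eval_mem_of_evalBoxLE h (pt_mem_regionBox hB.1 hB.2 hθ hs)
  rw [mem_ratCast_iff] at hm
  unfold GsField
  rw [abs_le]
  constructor
  · have := hm.1; push_cast at this; exact this
  · exact hm.2

/-- **`|∂_s G| ≤ M_G` on `Θ × [s⁻, s⁺]` (with `0 < s⁻`, `s⁺ < 1`) ⇒ `Gfield(θ, ·)` is `M_G`-Lipschitz there.** -/
theorem G_lipschitz_of_Gs {θ slo shi MG : ℝ} (h0 : 0 < slo) (h1 : shi < 1)
    (hGs : ∀ s ∈ Icc slo shi, |GsField θ s| ≤ MG) {s s' : ℝ} (hs : s ∈ Icc slo shi) (hs' : s' ∈ Icc slo shi) :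
    |Gfield θ s - Gfield θ s'| ≤ MG * |s - s'| := by
  have h := Convex.norm_image_sub_le_of_norm_hasDerivWithin_le (f := Gfield θ) (f' := GsField θ) (s := Icc slo shi)
    (fun x hx => (hasDerivAt_Gfield (X_pos_of_box h0.le h1 hx) (h0.trans_le hx.1).ne').hasDerivWithinAt)
    (fun x hx => by rw [Real.norm_eq_abs]; exact hGs x hx) (convex_Icc _ _) hs' hs
  rw [Real.norm_eq_abs, Real.norm_eq_abs] at h
  exact h

end Summit.Ventures.FusionMHD.Models.CFIterLike.QHalf

end
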